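import Summits.Ventures.CertifiedManyBodySolver.Theorems.M3x2EdgeSplitSymReplaySoundC
import Summits.Ventures.CertifiedManyBodySolver.Theorems.M3PrimeEdgeSplitLowerEdge_ge_m4o5SlackAbsorb
import HarnessLib

/-!
# SymReplay S4 layer D — the Gram multiplier: SOS factors ⊕ matrix blocks `scale • L Lᴴ` (merge dot = dense dot), block-diagonal, re-indexed (T9; hub-lb-sym-eng-3)
No summit or crux statement is proved here; no certificate beyond toys is replayed; nothing here predicts superconductivity.
-/

noncomputable section

namespace Summit.Ventures.CertifiedManyBodySolver.Theorems.SymReplay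

open Matrix Finset
open Literature.MathematicalPhysics.QuantumLattice
open Literature.MathematicalPhysics.QuantumLattice.HubbardWave0
open Literature.MathematicalPhysics.QuantumLattice.ThermodynamicLimit
open Literature.Probability.LatticeModels
open Literature.MathematicalPhysics.QuantumManyBody.StateRelaxation
open Summit.Ventures.CertifiedManyBodySolver.Theorems.WardSlot
open scoped ComplexOrder BigOperators

/-! ##### (j) The Gram multiplier: SOS factors (`gram`, diagonal) ⊕ matrix-form blocks (`gramM`, `scale • L Lᴴ`
from the sparse exact rows), block-diagonal, then re-indexed by `Fin` -/

/-- Helper `rowCoef_nil` (S4 chain). -/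
theorem rowCoef_nil (k : ℕ) : rowCoef [] k = 0 := rfl

/-- Helper `rowCoef_cons` (S4 chain). -/
theorem rowCoef_cons (a : ℚ) (i : ℕ) (r : List (ℚ × ℕ)) (k : ℕ) :
    rowCoef ((a, i) :: r) k = (if i = k then a else 0) + rowCoef r k := by
  simp [rowCoef]

/-- Helper `rowAsc_cons_cons` (S4 chain). -/
theorem rowAsc_cons_cons (a : ℚ) (i : ℕ) (b : ℚ) (j : ℕ) (r : List (ℚ × ℕ)) :
    rowAsc ((a, i) :: (b, j) :: r) = (decide (i < j) && rowAsc ((b, j) :: r)) := rfl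

/-- Helper `rowAsc_tail` (S4 chain). -/
theorem rowAsc_tail {a : ℚ} {i : ℕ} : ∀ {r : List (ℚ × ℕ)}, rowAsc ((a, i) :: r) = true → rowAsc r = true
  | [], _ => rfl
  | (b, j) :: r, h => by
    rw [rowAsc_cons_cons, Bool.and_eq_true] at h
    exact h.2

/-- In an ascending row every later column exceeds the first. -/
theorem rowAsc_lt : ∀ {a : ℚ} {i : ℕ} {r : List (ℚ × ℕ)}, rowAsc ((a, i) :: r) = true → ∀ e ∈ r, i < e.2
  | _, _, [], _, e, he => absurd he (by simp)
  | a, i, (b, j) :: r, h, e, he => by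
    rw [rowAsc_cons_cons, Bool.and_eq_true, decide_eq_true_eq] at h
    rcases List.mem_cons.1 he with rfl | he
    · exact h.1
    · exact lt_trans h.1 (rowAsc_lt h.2 e he)

/-- Helper `rowCoef_eq_zero_of_lt` (S4 chain). -/
theorem rowCoef_eq_zero_of_lt : ∀ {r : List (ℚ × ℕ)} {k : ℕ}, (∀ e ∈ r, k < e.2) → rowCoef r k = 0
  | [], _, _ => rfl
  | (a, i) :: r, k, h => by
    rw [rowCoef_cons, if_neg (h (a, i) List.mem_cons_self).ne', zero_add]
    exact rowCoef_eq_zero_of_lt fun e he => h e (List.mem_cons_of_mem _ he)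

/-- **The merge dot product is the dense dot product** on ascending rows whose columns lie in `T`. -/
theorem sdotF_eq (T : Finset ℕ) : ∀ (n : ℕ) (r r' : List (ℚ × ℕ)) (acc : ℚ),
    r.length + r'.length ≤ n → rowAsc r = true → rowAsc r' = true →
    (∀ e ∈ r, e.2 ∈ T) → (∀ e ∈ r', e.2 ∈ T) →
    sdotF n r r' acc = acc + ∑ k ∈ T, rowCoef r k * rowCoef r' k
  | 0, r, r', acc, hn, _, _, _, _ => by
    have hr : r = [] := List.eq_nil_of_length_eq_zero (by omega)
    have hr' : r' = [] := List.eq_nil_of_length_eq_zero (by omega)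
    subst hr hr'
    simp [sdotF, rowCoef_nil]
  | n + 1, [], r', acc, _, _, _, _, _ => by simp [sdotF, rowCoef_nil]
  | n + 1, (a, i) :: r, [], acc, _, _, _, _, _ => by simp [sdotF, rowCoef_nil]
  | n + 1, (a, i) :: r, (b, j) :: r', acc, hn, hr, hr', hT, hT' => by
    have hri : ∀ e ∈ r, i < e.2 := rowAsc_lt hr
    have hrj : ∀ e ∈ r', j < e.2 := rowAsc_lt hr'
    have hiT : i ∈ T := hT _ List.mem_cons_self
    have hn' : r.length + r'.length + 1 ≤ n := by simp only [List.length_cons] at hn; omega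
    rw [sdotF]
    by_cases hij : i < j
    · rw [if_pos hij, sdotF_eq T n r ((b, j) :: r') acc (by simp only [List.length_cons]; omega) (rowAsc_tail hr) hr'
        (fun e he => hT e (List.mem_cons_of_mem _ he)) hT']
      congr 1
      refine Finset.sum_congr rfl fun k _ => ?_
      rw [rowCoef_cons a i]
      by_cases hk : i = k
      · subst hk
        have h0 : rowCoef ((b, j) :: r') i = 0 := rowCoef_eq_zero_of_lt fun e he => by
          rcases List.mem_cons.1 he with rfl | he
          · exact hij
          · exact lt_trans hij (hrj e he)
        rw [h0, mul_zero, mul_zero]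
      · rw [if_neg hk, zero_add]
    · rw [if_neg hij]
      by_cases hji : j < i
      · rw [if_pos hji, sdotF_eq T n ((a, i) :: r) r' acc (by simp only [List.length_cons]; omega) hr (rowAsc_tail hr')
          hT (fun e he => hT' e (List.mem_cons_of_mem _ he))]
        congr 1
        refine Finset.sum_congr rfl fun k _ => ?_
        rw [rowCoef_cons b j]
        by_cases hk : j = k
        · subst hk
          have h0 : rowCoef ((a, i) :: r) j = 0 := rowCoef_eq_zero_of_lt fun e he => by
            rcases List.mem_cons.1 he with rfl | he
            · exact hji
            · exact lt_trans hji (hri e he)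
          rw [h0, zero_mul, zero_mul]
        · rw [if_neg hk, zero_add]
      · rw [if_neg hji]
        have hij' : i = j := by omega
        subst hij'
        rw [sdotF_eq T n r r' (acc + a * b) (by omega) (rowAsc_tail hr) (rowAsc_tail hr')
          (fun e he => hT e (List.mem_cons_of_mem _ he)) (fun e he => hT' e (List.mem_cons_of_mem _ he)), add_assoc]
        congr 1
        have hri0 : rowCoef r i = 0 := rowCoef_eq_zero_of_lt hri
        have hrj0 : rowCoef r' i = 0 := rowCoef_eq_zero_of_lt hrj
        symm
        calc ∑ k ∈ T, rowCoef ((a, i) :: r) k * rowCoef ((b, i) :: r') k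
            = ∑ k ∈ T, ((if i = k then a * b else 0) + rowCoef r k * rowCoef r' k) := by
              refine Finset.sum_congr rfl fun k _ => ?_
              rw [rowCoef_cons, rowCoef_cons]
              by_cases hk : i = k
              · subst hk; rw [if_pos rfl, if_pos rfl, if_pos rfl, hri0, hrj0]; ring
              · rw [if_neg hk, if_neg hk, if_neg hk]; ring
          _ = a * b + ∑ k ∈ T, rowCoef r k * rowCoef r' k := by
              rw [Finset.sum_add_distrib, Finset.sum_ite_eq T i, if_pos hiT]

/-- Helper `sdot_eq_sum` (S4 chain). -/
theorem sdot_eq_sum (Kb : ℕ) (r r' : List (ℚ × ℕ)) (hr : rowAsc r = true) (hr' : rowAsc r' = true)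
    (hT : ∀ e ∈ r, e.2 < Kb) (hT' : ∀ e ∈ r', e.2 < Kb) :
    sdot r r' = ∑ k : Fin Kb, rowCoef r k * rowCoef r' k := by
  rw [sdot, sdotF_eq (Finset.range Kb) _ r r' 0 le_rfl hr hr' (fun e he => Finset.mem_range.2 (hT e he))
    (fun e he => Finset.mem_range.2 (hT' e he)), zero_add, Fin.sum_univ_eq_sum_range (fun k => rowCoef r k * rowCoef r' k)]

/-- Helper `le_foldr_max` (S4 chain). -/
theorem le_foldr_max : ∀ (l : List ℕ) (x : ℕ), x ∈ l → x ≤ l.foldr max 0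
  | [], x, h => absurd h (by simp)
  | y :: l, x, h => by
    rw [List.foldr_cons]
    rcases List.mem_cons.1 h with rfl | h
    · exact le_max_left _ _
    · exact (le_foldr_max l x h).trans (le_max_right _ _)

/-- Helper `lt_colBound` (S4 chain). -/
theorem lt_colBound (B : GramBlock) {r : List (ℚ × ℕ)} (hr : r ∈ B.rows) {e : ℚ × ℕ} (he : e ∈ r) :
    e.2 < colBound B :=
  Nat.lt_succ_of_le (le_foldr_max _ _ (List.mem_flatMap.2 ⟨r, hr, List.mem_map.2 ⟨e, he, rfl⟩⟩))

/-- Helper `blockMat_apply` (S4 chain). -/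
theorem blockMat_apply (B : GramBlock) (hrows : ∀ r ∈ B.rows, rowAsc r = true)
    (i j : Fin (blockPairs B).length) :
    blockMat B i j = ((B.scale * sdot ((blockPairs B).get i).2 ((blockPairs B).get j).2 : ℚ) : ℂ) := by
  have hi : ((blockPairs B).get i).2 ∈ B.rows := (List.of_mem_zip (List.get_mem _ i)).2
  have hj : ((blockPairs B).get j).2 ∈ B.rows := (List.of_mem_zip (List.get_mem _ j)).2
  rw [blockMat, Matrix.smul_apply, Matrix.mul_apply, sdot_eq_sum (colBound B) _ _ (hrows _ hi) (hrows _ hj)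
    (fun e he => lt_colBound B hi he) (fun e he => lt_colBound B hj he), Rat.cast_mul, Rat.cast_sum, smul_eq_mul]
  congr 1
  refine Finset.sum_congr rfl fun k _ => ?_
  rw [Matrix.conjTranspose_apply, blockL, blockL, Rat.cast_mul]
  congr 1
  rw [← Complex.ofReal_ratCast, Complex.star_def, Complex.conj_ofReal]

/-- Helper `blockMat_posSemidef` (S4 chain). -/
theorem blockMat_posSemidef (B : GramBlock) (hs : 0 ≤ B.scale) : (blockMat B).PosSemidef :=
  (Matrix.posSemidef_self_mul_conjTranspose (blockL B)).smul
    (by rw [← Complex.ofReal_ratCast]; exact Complex.zero_le_real.2 (by exact_mod_cast hs))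

/-- **A matrix-form Gram block is a Gram form with the PSD multiplier `scale • L Lᴴ`.** -/
theorem polyOp_gramBlockPoly (Λ' : Finset (Site 2)) (B : GramBlock) (hrows : ∀ r ∈ B.rows, rowAsc r = true) :
    polyOp Λ' (gramBlockPoly B) = gramForm (blockMat B) (fun i => polyOp Λ' ((blockPairs B).get i).1) := by
  unfold gramForm
  simp only [blockMat_apply B hrows, Matrix.star_eq_conjTranspose]
  unfold gramBlockPoly
  dsimp only
  rw [polyOp_pscale, polyOp_flatMap, ← sum_fin_get, Finset.smul_sum]
  refine Finset.sum_congr rfl fun i _ => ?_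
  rw [polyOp_flatMap, ← sum_fin_get, Finset.smul_sum]
  refine Finset.sum_congr rfl fun j _ => ?_
  split_ifs with h0
  · rw [h0, mul_zero, Rat.cast_zero, zero_smul, polyOp_nil, smul_zero]
  · rw [polyOp_pscale, polyOp_pmul, polyOp_padj, smul_smul, ← Rat.cast_mul]

/-- Helper `gramForm_fromBlocks_diag'` (S4 chain). -/
theorem gramForm_fromBlocks_diag' {Λ' : Finset (Site 2)} {m n : Type*} [Fintype m] [Fintype n] (A : Matrix m m ℂ)
    (D : Matrix n n ℂ) (O : m → FermionOp Λ') (F : n → FermionOp Λ') :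
    gramForm (Matrix.fromBlocks A 0 0 D) (Sum.elim O F) = gramForm A O + gramForm D F := by
  simp [gramForm, Fintype.sum_sum_type]

/-- Helper `gramForm_blockDiagonal'` (S4 chain). -/
theorem gramForm_blockDiagonal' {Λ' : Finset (Site 2)} {β : Type*} [Fintype β] [DecidableEq β] {mb : β → Type*}
    [∀ b, Fintype (mb b)] [∀ b, DecidableEq (mb b)]
    (Z : (b : β) → Matrix (mb b) (mb b) ℂ) (O : (b : β) → mb b → FermionOp Λ') :
    gramForm (Matrix.blockDiagonal' Z) (fun p : (b : β) × mb b => O p.1 p.2) = ∑ b, gramForm (Z b) (O b) := by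
  unfold gramForm
  rw [Fintype.sum_sigma]
  refine Finset.sum_congr rfl fun b _ => Finset.sum_congr rfl fun i _ => ?_
  rw [Fintype.sum_sigma, Finset.sum_eq_single b]
  · simp [Matrix.blockDiagonal'_apply_eq]
  · intro b' _ hb'
    simp [Matrix.blockDiagonal'_apply_ne _ _ _ (Ne.symm hb')]
  · simp

/-- Helper `gramForm_reindex` (S4 chain). -/
theorem gramForm_reindex {Λ' : Finset (Site 2)} {ι : Type*} [Fintype ι] {n : ℕ} (e : Fin n ≃ ι)
    (M : Matrix ι ι ℂ) (O : ι → FermionOp Λ') : gramForm (M.submatrix e e) (O ∘ e) = gramForm M O := by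
  calc gramForm (M.submatrix e e) (O ∘ e)
      = ∑ i, ∑ j, M (e i) (e j) • (star (O (e i)) * O (e j)) := rfl
    _ = ∑ i, ∑ j : ι, M (e i) j • (star (O (e i)) * O j) :=
        Finset.sum_congr rfl fun i _ => e.sum_comp (fun j => M (e i) j • (star (O (e i)) * O j))
    _ = ∑ i : ι, ∑ j : ι, M i j • (star (O i) * O j) := e.sum_comp (fun i => ∑ j, M i j • (star (O i) * O j))
    _ = gramForm M O := rfl

/-- Helper `gramMat_posSemidef` (S4 chain). -/
theorem gramMat_posSemidef (K : SymCert) (hg : ∀ g ∈ K.gram, 0 ≤ g.1) (hM : ∀ B ∈ K.gramM, 0 ≤ B.scale) :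
    (gramMat K).PosSemidef := by
  refine posSemidef_fromBlocks_diag (Matrix.posSemidef_diagonal_iff.2 fun k => ?_)
    (posSemidef_blockDiagonal' fun b => blockMat_posSemidef _ (hM _ (List.get_mem _ b)))
  rw [← Complex.ofReal_ratCast]
  exact Complex.zero_le_real.2 (by exact_mod_cast hg _ (List.get_mem _ k))

/-- **The Gram part of `rhsPoly` is ONE Gram form with a PSD multiplier.** -/
theorem gramForm_gramMat (K : SymCert) (Λ' : Finset (Site 2)) (hrows : ∀ B ∈ K.gramM, ∀ r ∈ B.rows, rowAsc r = true) :
    gramForm (gramMat K) (gramGen K Λ') =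
      polyOp Λ' (K.gram.flatMap fun g => pscale g.1 (pmul (padj g.2) g.2)) + polyOp Λ' (K.gramM.flatMap gramBlockPoly) := by
  rw [gramMat, gramGen, gramForm_fromBlocks_diag', gramForm_diagonal_fin, gramForm_blockDiagonal']
  congr 1
  · rw [polyOp_flatMap, ← sum_fin_get]
    refine Finset.sum_congr rfl fun k _ => ?_
    rw [polyOp_pscale, polyOp_pmul, polyOp_padj]
  · rw [polyOp_flatMap, ← sum_fin_get]
    refine Finset.sum_congr rfl fun b _ => ?_
    exact (polyOp_gramBlockPoly Λ' _ (hrows _ (List.get_mem _ b))).symm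

end Summit.Ventures.CertifiedManyBodySolver.Theorems.SymReplay

end
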